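import Summits.AnomalousDissipation.AnomalousDissipation.Theses.HopfSnake

/-!
# Route HopfSnake — glue item `LoudSnakeGlue` (stmt-AnomalousDissipation-14104)

Pure-logic glue of the two rev-4 cruxes of route HopfSnake into the route target:
`BoundedSnakeToZero3D → BoundedSnakesAreLoud3D → BoundedLoudSnake`.
Take the genuinely three-dimensional force `f` and its bounded (d)-snake `(ν, u, p)` with
energy bound from `BoundedSnakeToZero3D`, instantiate the universal loudness statement
`BoundedSnakesAreLoud3D` at `(f, ν, u, p)`, and repackage as `BoundedLoudSnake`
(the 3-D side condition on `f` is forgotten). No analysis is involved.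
-/

-- `Summit.<Summit>.<Problem>` is the tree's mandated summit-side namespace (CONVENTIONS §2); for this
-- single-conjunct summit the two coincide, so the duplicate is deliberate.
set_option linter.dupNamespace false

namespace Summit.AnomalousDissipation.AnomalousDissipation.Theorems

open Summit.AnomalousDissipation.AnomalousDissipation.Theses.HopfSnake

/-- **Glue item `LoudSnakeGlue` of route HopfSnake (stmt-AnomalousDissipation-14104).**
`BoundedSnakeToZero3D → BoundedSnakesAreLoud3D → BoundedLoudSnake`: the bounded (d)-snake of a
genuinely three-dimensional force given by the selection crux, fed to the universal loudness crux,
is a bounded loud snake. Pure instantiation. -/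
theorem loudSnakeGlue_proof :
    Summit.AnomalousDissipation.AnomalousDissipation.Theses.HopfSnake.LoudSnakeGlue := by
  unfold LoudSnakeGlue
  rintro ⟨f, hf, hdiv, hmean, h3d, ν, u, p, hsnake, hE⟩ hloud
  exact ⟨f, hf, hdiv, hmean, ν, u, p, hsnake, hE, hloud f hf hdiv hmean h3d ν u p hsnake hE⟩

end Summit.AnomalousDissipation.AnomalousDissipation.Theorems
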